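import Summits.QuantumFields.YangMills.Theorems.BalabanUVNodesN08AlphaEq324RowClassSocketEndUnitRange

/-!
# Route «BalabanUVNodes», Track-A DAG node N08 = [Balaban1985UV3] Thm 1 p. 257 ∕ Thm 2 p. 272 — THE (α)-SOCKET WITH A SANDWICHED CUT-OFF (CHECK D):
# the (3.24) row `h324` of the edited clauses at EVERY run step for an a.e. presentation of the step block by a class member whose small-field BOX is only
# SANDWICHED between two coordinate boxes `Πχ̂_{I, p(g_k)∕λ} ⊆ Φ⁻¹'χ ⊆ Πχ̂_{I, p(g_k)}` (a.e.) — the shape [Balaban1985UV3]'s χ (a product of Hilbert–Schmidt BALLS in `𝔤`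
# per bond, (51) p.268 ∕ (58) p.270) actually has for `d(𝔤) ≥ 2` (part 11 of the class socket)

Cell `pub-ymgap`, seat `pub-ymgap-dag-n08-w4` gen 6 (CLAIM-6 ∕ INTENT-6, INBOX l.40976).  `bears_on: R4∕N08`; filed `--supports stmt-QuantumFields-27364` (K1⁹, helper).  THEOREMS ONLY
(def-free, sorry-free, standard axioms); seat n08-b's `…KernelEq324AnyGammaUnitRange.eq324_kernel_of_expDecay_on_unit` (p641950), parts 1∕2's transport lemmas and the
(3.24) arithmetic of seat n08-d's `B1Eq324CumulantTaylor.eq324_iff_abs_log_sub_le` consumed BY NAME.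

WHY (seat n08-b's LOCATED «N08 CHECK D (CUT-OFF SHAPE)», INBOX l.40922).  Every END of this socket so far reads the small-field cut-off through the row
`hbox : Φ⁻¹'χ =ᵐ smallFieldSet I (p(g_k))` — a COORDINATE BOX in the presenting coordinates.  Print's cut-off is not one: [Balaban1985UV3] (51)∕(58) has
`χ = Π_{b ∈ B(Λ_{k+1})} χ({|A(b)| < g_k p(g_k)})` with `A(b) ∈ 𝔤` and `|·|` the Hilbert–Schmidt norm ([Balaban1985BackgroundPropagators] p.390), a product of Euclidean BALLS in
`ℝ^{d(𝔤)}` per bond, which for `d(𝔤) ≥ 2` is a coordinate box in NO coordinates ([Balaban1982Higgs1] (3.24) itself is stated for an N-component field with `|φ(x)|` Euclidean).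
What the ball does satisfy is a SANDWICH between the boxes of radii `p∕√d(𝔤)` and `p` (n08-b's Literature half).  This part shows the sandwich is all row `h324` needs: the class road is
read at BOTH thresholds `p(g_k)∕λ = p_{b₀∕λ}(g_k)` and `p(g_k)` (window `λ·b₁ < b₀`), `∫_{small} e^{H} ≤ ∫_{χ} e^{𝒱} ≤ ∫_{big} e^{H}` by monotonicity (`e^{H} ≥ 0`, a.e. inclusions), the
free cumulants do not see the box, and `Eq324` passes to anything squeezed between two quantities obeying it with the same cumulants and constants (§1).
* §1 `eq324_of_sandwich` — `Eq324 Z₁ cum n̄ C s κ vol`, `Eq324 Z₂ cum n̄ C s κ vol`, `Z₁ ≤ Z ≤ Z₂` ⟹ `Eq324 Z cum n̄ C s κ vol` (log-monotonicity).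
* §2 `integrableOn_exp_of_eq324` (an `Eq324` left-hand side is a genuine integral: `e^{H}` integrable on the set), ★ `eq324_box_of_sandwichedPresentation_ae` — block-generic
  transport: `μ𝔖 = μ.map Φ`, `s ≤ᵐ[μ] Φ⁻¹'box ≤ᵐ[μ] t`, `V ∘ Φ =ᵐ H`, `Eq324` for `(∫_s e^H dμ, ℰ_μᵀ(H;·))` and for `(∫_t e^H dμ, ℰ_μᵀ(H;·))` ⟹ `Eq324` for
  `(∫_{box} e^V dμ𝔖, free moment-cumulants of V)`, same constants.
* §3 ★★★★ `exists_threshold_h324Row_freeLetter_of_expDecayPresentation_sandwichedBox_allSteps_ae` — part 7's END (p642420: η-route, Sect. E currency, any `γ_A > 0`, every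
  `k ≤ K`) with `hbox` REPLACED by the two a.e. inclusions `smallFieldSet (I h U) (p_{b₀∕λ}(g_k)) ≤ᵐ Φ⁻¹'(𝔖 k).box h ≤ᵐ smallFieldSet (I h U) (p_{b₀}(g_k))`, ratio `λ ≥ 1`
  (print: `λ = √d(𝔤)`), window `∃ b₁ ≥ 0, ∀ b₀ λ, 1 ≤ λ → λ·b₁ < b₀ → ∃ C ≥ 0 …`; `…_rec_one` (`p₀ := 𝔠.p₀`, `σ = 1`).
HONEST SCOPE.  Compositions by name + ten lines of real analysis; member ∕ presentation ∕ sandwich ∕ Hamiltonian letters ∕ window ∕ budget are HYPOTHESES (IDENT = NODE 00 objects +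
N06 in-edges, NOT commissioned, NOT claimed; the ball-between-boxes inclusions for [B10]'s χ are n08-b's Literature half); nothing of [Balaban1985UV3] ∕ [BenfattoEtAl1978] ∕
[Balaban1985BackgroundPropagators] asserted or discharged; `PrintedUV3V` NOT proved; N08 NOT discharged; count-neutral; one finite 𝕋⁴ programme at fixed ε — R4 closes the
conditional finite-𝕋⁴ rung `BalabanLadder.UV` only; nothing continuum ∕ ℝ⁴ ∕ OS ∕ mass gap ∕ Clay.
-/

noncomputable section

namespace Summit.QuantumFields.YangMills.Theorems.BalabanUVNodesN08AlphaEq324RowClassSocketEndSandwiched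

open MeasureTheory
open scoped BigOperators Nat
open Literature.MathematicalPhysics.QuantumFieldTheory (gaussianFieldOfKernel)
open Literature.MathematicalPhysics.QuantumFieldTheory.Balaban1983to89
open Literature.MathematicalPhysics.QuantumFieldTheory.Balaban1983to89.B1Sect3Statements (Eq324)
open Literature.MathematicalPhysics.QuantumFieldTheory.Balaban1983to89.B1Eq324BenfattoLemma
  (Coef hamiltonian coefSup smallFieldSet cutoffBoltzmann truncatedExp cumulantSum)
open Literature.MathematicalPhysics.QuantumFieldTheory.Balaban1983to89.B1Eq324CumulantTaylor (eq324_iff_abs_log_sub_le)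
open Literature.MathematicalPhysics.QuantumFieldTheory.Balaban1983to89.B1Eq324BenfattoKernelEq324AnyGammaUnitRange (eq324_kernel_of_expDecay_on_unit)
open Literature.MathematicalPhysics.QuantumFieldTheory.Balaban1985CMP102.Setting
open Summit.QuantumFields.Balaban3D.Carriers
open Summit.QuantumFields.Balaban3D.Proofs.ScalesArithmetic (gk_pos gk_le_one g0sq_pos L_pos sites_nonneg)
open Summit.QuantumFields.Balaban3D.Proofs.Primitives (AlphaConsts)
open Summit.QuantumFields.Balaban3D.Proofs.GroupModelLieC (lieC)
open Summit.QuantumFields.YangMills.Theorems.BalabanUVNodesN08AlphaEq324RowSocket (eq324_mono)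
open Summit.QuantumFields.YangMills.Theorems.BalabanUVNodesN08AlphaEq324RowCumLetterModel (budget_le_vol gk_rpow_six_add setIntegral_exp_map_eq)
open Summit.QuantumFields.YangMills.Theorems.BalabanUVNodesN08AlphaEq324RowClassSocket (integral_cutoffBoltzmann_eq_setIntegral')
open Summit.QuantumFields.YangMills.Theorems.BalabanUVNodesN08AlphaEq324RowClassSocketAE (cumulantOf_moments_map_eq_of_ae)
open Literature.Probability.LatticeModels (cumulantOf)

/-! ## §1 `Eq324` passes to anything squeezed between two quantities that obey it -/

/-- **Squeeze for (3.24)**: if `Z₁ ≤ Z ≤ Z₂` and both `Z₁`, `Z₂` equal `exp(Σ_{n ≤ n̄} cum n ∕ n! + r)` with `|r| ≤ C s^κ vol`, so does `Z`. [folklore] -/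
theorem eq324_of_sandwich {Z₁ Z₂ Z : ℝ} {cum : ℕ → ℝ} {nbar : ℕ} {C s κ vol : ℝ} (h₁ : Eq324 Z₁ cum nbar C s κ vol) (h₂ : Eq324 Z₂ cum nbar C s κ vol)
    (hlo : Z₁ ≤ Z) (hhi : Z ≤ Z₂) : Eq324 Z cum nbar C s κ vol := by
  obtain ⟨r₁, hr₁, hZ₁⟩ := h₁
  obtain ⟨r₂, hr₂, hZ₂⟩ := h₂
  have hZ₁pos : 0 < Z₁ := by rw [hZ₁]; exact Real.exp_pos _
  have hZpos : 0 < Z := lt_of_lt_of_le hZ₁pos hlo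
  refine ⟨Real.log Z - ∑ n ∈ Finset.Icc 1 nbar, cum n / (n.factorial : ℝ), ?_, by rw [add_sub_cancel, Real.exp_log hZpos]⟩
  have hl₁ : (∑ n ∈ Finset.Icc 1 nbar, cum n / (n.factorial : ℝ)) + r₁ ≤ Real.log Z := by
    rw [← Real.log_exp (∑ n ∈ Finset.Icc 1 nbar, cum n / (n.factorial : ℝ) + r₁), ← hZ₁]; exact Real.log_le_log hZ₁pos hlo
  have hl₂ : Real.log Z ≤ (∑ n ∈ Finset.Icc 1 nbar, cum n / (n.factorial : ℝ)) + r₂ := by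
    rw [← Real.log_exp (∑ n ∈ Finset.Icc 1 nbar, cum n / (n.factorial : ℝ) + r₂), ← hZ₂]; exact Real.log_le_log hZpos hhi
  rw [abs_le] at hr₁ hr₂ ⊢
  constructor <;> linarith [hr₁.1, hr₂.2]

/-! ## §2 The block-generic transport with a sandwiched box -/

section Transport

variable {d : ℕ} {Fl : Type*} [MeasurableSpace Fl]

/-- An `Eq324` left-hand side is a genuine integral: `z ↦ e^{H z}` is integrable on the set (else the Bochner integral would vanish, but it equals an exponential).
[folklore] -/
theorem integrableOn_exp_of_eq324 (μ : Measure ((Fin d → ℤ) → ℝ)) {t : Set ((Fin d → ℤ) → ℝ)} {H : ((Fin d → ℤ) → ℝ) → ℝ} {cum : ℕ → ℝ} {nbar : ℕ}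
    {C s κ vol : ℝ} (h : Eq324 (∫ z in t, Real.exp (H z) ∂μ) cum nbar C s κ vol) : IntegrableOn (fun z => Real.exp (H z)) t μ := by
  by_contra hni
  obtain ⟨r, -, hZ⟩ := h
  rw [integral_undef hni] at hZ
  exact (Real.exp_pos _).ne' hZ.symm

/-- ★ **THE TRANSPORT WITH A SANDWICHED BOX.**  A fluctuation block `(Fl, μ𝔖, box, V)` presented by a lattice-field model `μ` — `μ𝔖 = μ.map Φ`, `Φ` measurable, `V ∘ Φ =ᵐ[μ] H` — whose
box is only SQUEEZED a.e. between two sets, `s ≤ᵐ[μ] Φ⁻¹'box ≤ᵐ[μ] t`: if `(∫_s e^H dμ, ℰ_μᵀ(H;·))` and `(∫_t e^H dμ, ℰ_μᵀ(H;·))` obey `Eq324` with the same constants, so does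
`(∫_{box} e^V dμ𝔖, free moment-cumulants of V under μ𝔖)`. [cite: Balaban1985UV3, (51) p.268 + (58) p.270; Balaban1982Higgs1, (3.24) p.616; BenfattoEtAl1978, (2.7) p.147 (bookkeeping)] -/
theorem eq324_box_of_sandwichedPresentation_ae {μ𝔖 : Measure Fl} {box : Set Fl} {V : Fl → ℝ}
    (μ : Measure ((Fin d → ℤ) → ℝ)) {Φ : ((Fin d → ℤ) → ℝ) → Fl} (hΦ : Measurable Φ) (hμ : μ𝔖 = μ.map Φ) (hboxm : MeasurableSet box) (hVm : Measurable V)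
    {s t : Set ((Fin d → ℤ) → ℝ)} (hlo : s ≤ᵐ[μ] Φ ⁻¹' box) (hhi : Φ ⁻¹' box ≤ᵐ[μ] t) {H : ((Fin d → ℤ) → ℝ) → ℝ} (hV : (fun z => V (Φ z)) =ᵐ[μ] H)
    {nbar : ℕ} {C sc κ vol : ℝ} (h₁ : Eq324 (∫ z in s, Real.exp (H z) ∂μ) (fun n => truncatedExp μ H n) nbar C sc κ vol)
    (h₂ : Eq324 (∫ z in t, Real.exp (H z) ∂μ) (fun n => truncatedExp μ H n) nbar C sc κ vol) :
    Eq324 (∫ ω in box, Real.exp (V ω) ∂μ𝔖) (fun n => cumulantOf (fun m => ∫ ω, V ω ^ m ∂μ𝔖) n) nbar C sc κ vol := by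
  subst hμ
  have hint : ∫ ω in box, Real.exp (V ω) ∂(μ.map Φ) = ∫ z in Φ ⁻¹' box, Real.exp (H z) ∂μ := by
    rw [setIntegral_exp_map_eq μ hΦ hboxm hVm]
    exact integral_congr_ae (ae_restrict_of_ae (hV.mono fun z hz => by simp only [← hz]))
  have hc : (fun n => cumulantOf (fun m => ∫ ω, V ω ^ m ∂(μ.map Φ)) n) = fun n => truncatedExp μ H n :=
    funext fun n => cumulantOf_moments_map_eq_of_ae μ hΦ hVm hV n
  rw [hint, hc]
  -- integrability on `t` (from `h₂`), hence on `Φ⁻¹' box`; then monotonicity of the set integral of `e^H ≥ 0` under the two a.e. inclusions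
  have hIt : IntegrableOn (fun z => Real.exp (H z)) t μ := integrableOn_exp_of_eq324 μ h₂
  have hIb : IntegrableOn (fun z => Real.exp (H z)) (Φ ⁻¹' box) μ := hIt.mono_set_ae hhi
  have hnn : ∀ u : Set ((Fin d → ℤ) → ℝ), 0 ≤ᵐ[μ.restrict u] fun z => Real.exp (H z) := fun u => Filter.Eventually.of_forall fun z => (Real.exp_pos _).le
  exact eq324_of_sandwich h₁ h₂ (setIntegral_mono_set hIb (hnn _) hlo) (setIntegral_mono_set hIt (hnn _) hhi)

end Transport

/-! ## §3 The η-route END with the box sandwiched -/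

variable {L : ℕ} {G : Type} [GaugeGroup G] [MeasurableSpace G] [HaarData G] (𝔊 : GroupModel G) (𝔠 : AlphaConsts L 𝔊.N) {d : ℕ}

/-- ★★★★ **THE (3.24) ROW AT EVERY RUN STEP FOR AN A.E. PRESENTATION WHOSE BOX IS SANDWICHED BETWEEN TWO COORDINATE BOXES** (η-route, Sect. E currency, any `γ_A > 0`; part 7's
END p642420 with `hbox` replaced).  Scalars as in part 7; THEN `∃ b₁ ≥ 0` such that for every `b₀` and every ratio `λ ≥ 1` with `λ·b₁ < b₀` there is `C ≥ 0` with: for every `S`,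
`𝔖`, `k ≤ K`, `v` (`C·v ≤ Ca + Cc`), member `(Λ, A, K)`, presentation `Φ` of the step block by `μ_K` (`(𝔖 k).μ = μ_K.map Φ`), cut-off sets `I h U` and Hamiltonian letters as in
part 7, and the SANDWICH `smallFieldSet (I h U) (p_{b₀∕λ}(g_k)) ≤ᵐ[μ_K] Φ⁻¹'(𝔖 k).box h ≤ᵐ[μ_K] smallFieldSet (I h U) (p_{b₀}(g_k))` (`p_b(g) = B10.pFun b p₀ g`, so
`p_{b₀∕λ} = p_{b₀}∕λ`), the row `StepAlphaEq324CoreLTAtAC.h324` ∕ `…CoreLTAt.h324` holds at the free letter.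
[cite: Balaban1985UV3, (51) p.268 + (58) p.270 + (7) p.257; Balaban1982Higgs1, (3.24) p.616; BenfattoEtAl1978, Lemma p.152 (class form; ours); Balaban1985BackgroundPropagators, Sect. E p.428 + p.390] -/
theorem exists_threshold_h324Row_freeLetter_of_expDecayPresentation_sandwichedBox_allSteps_ae (hd : 0 < d) {γA KA κA : ℝ} (hγA0 : 0 < γA)
    (hKA : 0 ≤ KA) (hκA : 0 < κA) (D : ℕ) {ϰ : ℝ} (hϰ : 0 < ϰ) {p₀ σ c₀ : ℝ} (hp₀ : 2 / 3 < p₀) (hσ : 0 < σ) (hc₀ : 0 ≤ c₀)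
    (hκσ : 6 + 2 * 𝔠.κ₀ < σ * (𝔠.nbar + 1)) :
    ∃ b₁ : ℝ, 0 ≤ b₁ ∧ ∀ b₀ lam : ℝ, 1 ≤ lam → lam * b₁ < b₀ → ∃ C : ℝ, 0 ≤ C ∧
      ∀ (S : Scales L) (𝔖 : ∀ k, StepSeries S G ↥(lieC 𝔊) (nblkOf S 𝔠.lane.carrier k) k) (k : ℕ), k ≤ S.K → ∀ (v : ℝ), C * v ≤ 𝔠.Ca + 𝔠.Cc →
        ∀ (Λ : Hist S.P (k + 1) → GaugeField S.P (k + 1) G → Finset (Fin d → ℤ))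
          (A : ∀ h U, Matrix ↥(Λ h U) ↥(Λ h U) ℝ) (K : Hist S.P (k + 1) → GaugeField S.P (k + 1) G → (Fin d → ℤ) → (Fin d → ℤ) → ℝ)
          (Φ : Hist S.P (k + 1) → GaugeField S.P (k + 1) G → ((Fin d → ℤ) → ℝ) → (𝔖 k).Fl)
          (s : ℕ) (I J : Hist S.P (k + 1) → GaugeField S.P (k + 1) G → Finset (Fin d → ℤ))
          (a : Hist S.P (k + 1) → GaugeField S.P (k + 1) G → Coef d),
          -- the members (Sect. E currency)
          (∀ h U x y, K h U x y = if hxy : x ∈ Λ h U ∧ y ∈ Λ h U then ((A h U)⁻¹ : Matrix ↥(Λ h U) ↥(Λ h U) ℝ) ⟨x, hxy.1⟩ ⟨y, hxy.2⟩ else 0) →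
          (∀ h U, (Λ h U).Nonempty) → (∀ h U e e', A h U e e' = A h U e' e) →
          (∀ h U (x : ↥(Λ h U) → ℝ), γA * ∑ e, x e ^ 2 ≤ ∑ e, ∑ e', A h U e e' * x e * x e') →
          (∀ h U (e e' : ↥(Λ h U)), |A h U e e'| ≤ KA * Real.exp (-(κA * Real.sqrt (∑ j, ((((e : Fin d → ℤ) j : ℝ) - ((e' : Fin d → ℤ) j : ℝ))) ^ 2)))) →
          -- the a.e. presentation, the box SANDWICHED
          (∀ h U, Measurable (Φ h U)) → (∀ h U, (𝔖 k).μ = (gaussianFieldOfKernel (K h U)).map (Φ h U)) →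
          (∀ h, MeasurableSet ((𝔖 k).box h)) → (∀ h U, Measurable ((𝔖 k).𝒱 h U)) →
          (∀ h U, smallFieldSet (I h U) (B10.pFun (b₀ / lam) p₀ (S.gk k)) ≤ᵐ[gaussianFieldOfKernel (K h U)] Φ h U ⁻¹' (𝔖 k).box h) →
          (∀ h U, Φ h U ⁻¹' (𝔖 k).box h ≤ᵐ[gaussianFieldOfKernel (K h U)] smallFieldSet (I h U) (B10.pFun b₀ p₀ (S.gk k))) →
          (∀ h U, (fun z => (𝔖 k).𝒱 h U (Φ h U z)) =ᵐ[gaussianFieldOfKernel (K h U)] hamiltonian s D ϰ (a h U) (J h U)) →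
          -- the instance data
          (∀ h U, (I h U).Nonempty) → (∀ h U, J h U ⊆ I h U) → (∀ h U, J h U ⊆ Λ h U) →
          (∀ h U, coefSup s D (a h U) (J h U) ≤ c₀ * S.gk k ^ σ) → (∀ h U, ((I h U).card : ℝ) ≤ v * S.sites k) →
          ∀ h (U : GaugeField S.P (k + 1) G),
            Eq324 (∫ ω in (𝔖 k).box h, Real.exp ((𝔖 k).𝒱 h U ω) ∂(𝔖 k).μ)
              (fun n => cumulantOf (fun m => ∫ ω, (𝔖 k).𝒱 h U ω ^ m ∂(𝔖 k).μ) n) 𝔠.nbar (𝔠.Ca + 𝔠.Cc)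
              ((L : ℝ) ^ k * S.g0sq) (3 + 𝔠.κ₀) (S.sites k) := by
  obtain ⟨b₁, hb₁⟩ :=
    eq324_kernel_of_expDecay_on_unit (d := d) hd hγA0 hKA hκA 𝔠.nbar D hϰ hp₀ hσ hc₀ (κ := 6 + 2 * 𝔠.κ₀) (by linarith [𝔠.κ₀_pos]) hκσ
  refine ⟨max b₁ 0, le_max_right _ _, fun b₀ lam hlam hb => ?_⟩
  have hlam0 : 0 < lam := lt_of_lt_of_le one_pos hlam
  -- both thresholds are inside the class road's window
  have hb_big : b₁ < b₀ := by
    have h1 : max b₁ 0 ≤ lam * max b₁ 0 := le_mul_of_one_le_left (le_max_right _ _) hlam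
    linarith [le_max_left b₁ 0]
  have hb_small : b₁ < b₀ / lam := by
    rw [lt_div_iff₀ hlam0, mul_comm]; linarith [le_max_left b₁ 0, mul_le_mul_of_nonneg_left (le_max_left b₁ 0) hlam0.le]
  obtain ⟨C₁, hC₁, hE₁⟩ := hb₁ b₀ hb_big
  obtain ⟨C₂, hC₂, hE₂⟩ := hb₁ (b₀ / lam) hb_small
  refine ⟨max C₁ C₂, le_max_of_le_left hC₁, ?_⟩
  intro S 𝔖 k hk v hCv Λ A K Φ s I J a hK hΛ hAs hγA hdec hΦ hμ hboxm hVm hlo hhi hV hI hJI hJΛ hA hIv h U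
  have hg := gk_pos S k
  have hg1 := gk_le_one S S.gK_le_one k hk
  -- the class road at the two thresholds, converted to [B10] currencies
  have hrow : ∀ {b C' : ℝ}, 0 ≤ C' → C' ≤ max C₁ C₂ →
      (0 < ∫ z, cutoffBoltzmann (hamiltonian s D ϰ (a h U) (J h U)) (I h U) (B10.pFun b p₀ (S.gk k)) z ∂gaussianFieldOfKernel (K h U) ∧
        |Real.log (∫ z, cutoffBoltzmann (hamiltonian s D ϰ (a h U) (J h U)) (I h U) (B10.pFun b p₀ (S.gk k)) z ∂gaussianFieldOfKernel (K h U)) -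
            cumulantSum (gaussianFieldOfKernel (K h U)) (hamiltonian s D ϰ (a h U) (J h U)) 𝔠.nbar| ≤ C' * S.gk k ^ (6 + 2 * 𝔠.κ₀) * (I h U).card) →
      Eq324 (∫ z in smallFieldSet (I h U) (B10.pFun b p₀ (S.gk k)), Real.exp (hamiltonian s D ϰ (a h U) (J h U) z) ∂gaussianFieldOfKernel (K h U))
        (fun n => truncatedExp (gaussianFieldOfKernel (K h U)) (hamiltonian s D ϰ (a h U) (J h U)) n) 𝔠.nbar (𝔠.Ca + 𝔠.Cc)
        ((L : ℝ) ^ k * S.g0sq) (3 + 𝔠.κ₀) (S.sites k) := by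
    intro b C' hC' hC'le hout
    obtain ⟨hpos, habs⟩ := hout
    rw [integral_cutoffBoltzmann_eq_setIntegral'] at hpos habs
    have h1 : Eq324 (∫ z in smallFieldSet (I h U) (B10.pFun b p₀ (S.gk k)), Real.exp (hamiltonian s D ϰ (a h U) (J h U) z) ∂gaussianFieldOfKernel (K h U))
        (fun n => truncatedExp (gaussianFieldOfKernel (K h U)) (hamiltonian s D ϰ (a h U) (J h U)) n) 𝔠.nbar (max C₁ C₂) (S.gk k) (6 + 2 * 𝔠.κ₀) (I h U).card := by
      rw [eq324_iff_abs_log_sub_le hpos]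
      refine le_trans (by simpa only [cumulantSum] using habs) ?_
      exact mul_le_mul_of_nonneg_right (mul_le_mul_of_nonneg_right hC'le (by positivity)) (Nat.cast_nonneg _)
    refine eq324_mono h1 ?_
    rw [gk_rpow_six_add]
    exact budget_le_vol (le_max_of_le_left hC₁) (mul_pos (pow_pos (L_pos S) k) (g0sq_pos S)) (sites_nonneg S k) (hIv h U) hCv
  have h_big := hrow hC₁ (le_max_left _ _)
    (hE₁ (S.gk k) hg hg1 (hK h U) (hΛ h U) (hAs h U) (hγA h U) (hdec h U) s (I h U) (J h U) (a h U) (hI h U) (hJI h U) (hJΛ h U) (hA h U))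
  have h_small := hrow hC₂ (le_max_right _ _)
    (hE₂ (S.gk k) hg hg1 (hK h U) (hΛ h U) (hAs h U) (hγA h U) (hdec h U) s (I h U) (J h U) (a h U) (hI h U) (hJI h U) (hJΛ h U) (hA h U))
  exact eq324_box_of_sandwichedPresentation_ae (gaussianFieldOfKernel (K h U)) (hΦ h U) (hμ h U) (hboxm h) (hVm h U) (hlo h U) (hhi h U) (hV h U)
    h_small h_big

/-- **… AT THE RECORD's OWN `p₀ = 𝔠.p₀` AND `σ = 1`** (`5 + 2κ₀ < n̄`), `b₀` and the ratio `λ` universal (print: `λ = √d(𝔤)`, `b₀ := 𝔠.b₀` with `√d(𝔤)·b₁ < 𝔠.b₀`).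
[cite: Balaban1985UV3, (7) p.257 + (51) p.268 + (58) p.270; Balaban1982Higgs1, (3.24) p.616; BenfattoEtAl1978, Lemma p.152 (class form; ours)] -/
theorem exists_threshold_h324Row_freeLetter_of_expDecayPresentation_sandwichedBox_allSteps_ae_rec_one (hd : 0 < d) {γA KA κA : ℝ} (hγA0 : 0 < γA)
    (hKA : 0 ≤ KA) (hκA : 0 < κA) (D : ℕ) {ϰ : ℝ} (hϰ : 0 < ϰ) {c₀ : ℝ} (hc₀ : 0 ≤ c₀) (hn : 5 + 2 * 𝔠.κ₀ < 𝔠.nbar) :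
    ∃ b₁ : ℝ, 0 ≤ b₁ ∧ ∀ b₀ lam : ℝ, 1 ≤ lam → lam * b₁ < b₀ → ∃ C : ℝ, 0 ≤ C ∧
      ∀ (S : Scales L) (𝔖 : ∀ k, StepSeries S G ↥(lieC 𝔊) (nblkOf S 𝔠.lane.carrier k) k) (k : ℕ), k ≤ S.K → ∀ (v : ℝ), C * v ≤ 𝔠.Ca + 𝔠.Cc →
        ∀ (Λ : Hist S.P (k + 1) → GaugeField S.P (k + 1) G → Finset (Fin d → ℤ))
          (A : ∀ h U, Matrix ↥(Λ h U) ↥(Λ h U) ℝ) (K : Hist S.P (k + 1) → GaugeField S.P (k + 1) G → (Fin d → ℤ) → (Fin d → ℤ) → ℝ)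
          (Φ : Hist S.P (k + 1) → GaugeField S.P (k + 1) G → ((Fin d → ℤ) → ℝ) → (𝔖 k).Fl)
          (s : ℕ) (I J : Hist S.P (k + 1) → GaugeField S.P (k + 1) G → Finset (Fin d → ℤ))
          (a : Hist S.P (k + 1) → GaugeField S.P (k + 1) G → Coef d),
          (∀ h U x y, K h U x y = if hxy : x ∈ Λ h U ∧ y ∈ Λ h U then ((A h U)⁻¹ : Matrix ↥(Λ h U) ↥(Λ h U) ℝ) ⟨x, hxy.1⟩ ⟨y, hxy.2⟩ else 0) →
          (∀ h U, (Λ h U).Nonempty) → (∀ h U e e', A h U e e' = A h U e' e) →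
          (∀ h U (x : ↥(Λ h U) → ℝ), γA * ∑ e, x e ^ 2 ≤ ∑ e, ∑ e', A h U e e' * x e * x e') →
          (∀ h U (e e' : ↥(Λ h U)), |A h U e e'| ≤ KA * Real.exp (-(κA * Real.sqrt (∑ j, ((((e : Fin d → ℤ) j : ℝ) - ((e' : Fin d → ℤ) j : ℝ))) ^ 2)))) →
          (∀ h U, Measurable (Φ h U)) → (∀ h U, (𝔖 k).μ = (gaussianFieldOfKernel (K h U)).map (Φ h U)) →
          (∀ h, MeasurableSet ((𝔖 k).box h)) → (∀ h U, Measurable ((𝔖 k).𝒱 h U)) →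
          (∀ h U, smallFieldSet (I h U) (B10.pFun (b₀ / lam) 𝔠.p₀ (S.gk k)) ≤ᵐ[gaussianFieldOfKernel (K h U)] Φ h U ⁻¹' (𝔖 k).box h) →
          (∀ h U, Φ h U ⁻¹' (𝔖 k).box h ≤ᵐ[gaussianFieldOfKernel (K h U)] smallFieldSet (I h U) (B10.pFun b₀ 𝔠.p₀ (S.gk k))) →
          (∀ h U, (fun z => (𝔖 k).𝒱 h U (Φ h U z)) =ᵐ[gaussianFieldOfKernel (K h U)] hamiltonian s D ϰ (a h U) (J h U)) →
          (∀ h U, (I h U).Nonempty) → (∀ h U, J h U ⊆ I h U) → (∀ h U, J h U ⊆ Λ h U) →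
          (∀ h U, coefSup s D (a h U) (J h U) ≤ c₀ * S.gk k) → (∀ h U, ((I h U).card : ℝ) ≤ v * S.sites k) →
          ∀ h (U : GaugeField S.P (k + 1) G),
            Eq324 (∫ ω in (𝔖 k).box h, Real.exp ((𝔖 k).𝒱 h U ω) ∂(𝔖 k).μ)
              (fun n => cumulantOf (fun m => ∫ ω, (𝔖 k).𝒱 h U ω ^ m ∂(𝔖 k).μ) n) 𝔠.nbar (𝔠.Ca + 𝔠.Cc)
              ((L : ℝ) ^ k * S.g0sq) (3 + 𝔠.κ₀) (S.sites k) := by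
  obtain ⟨b₁, hb₁0, hb₁⟩ :=
    exists_threshold_h324Row_freeLetter_of_expDecayPresentation_sandwichedBox_allSteps_ae 𝔊 𝔠 (d := d) hd hγA0 hKA hκA D hϰ (p₀ := 𝔠.p₀) (σ := 1)
      (by linarith [𝔠.two_lt_p₀]) one_pos hc₀ (by linarith)
  refine ⟨b₁, hb₁0, fun b₀ lam hlam hb => ?_⟩
  obtain ⟨C, hC, h⟩ := hb₁ b₀ lam hlam hb
  refine ⟨C, hC, ?_⟩
  intro S 𝔖 k hk v hCv Λ A K Φ s I J a hK hΛ hAs hγA hdec hΦ hμ hboxm hVm hlo hhi hV hI hJI hJΛ hA hIv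
  exact h S 𝔖 k hk v hCv Λ A K Φ s I J a hK hΛ hAs hγA hdec hΦ hμ hboxm hVm hlo hhi hV hI hJI hJΛ
    (fun h' U => by rw [Real.rpow_one]; exact hA h' U) hIv

end Summit.QuantumFields.YangMills.Theorems.BalabanUVNodesN08AlphaEq324RowClassSocketEndSandwiched

end
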